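import Summits.QuantumFields.YangMills.Theorems.WeakCouplingRatesHarmonicInteriorGradient
import Mathlib.NumberTheory.Harmonic.Bounds
import HarnessLib

/-!
# Flat-lattice input of the curvature-gradient bound, file 1/2: UNIFORM sup-norm Lawler bounds for the first and second
# differences of the Green kernel `g = G/2` of `−Δ` on `ℤ^d` (`d ≥ 3`), and the logarithmic shell sum
# `Σ_{‖y‖∞ ≤ N} (max 1 ‖y‖∞)^{−d} ≤ C (1 + log N)`

Helper file (`--supports stmt-QuantumFields-19200`, crux child «MinimiserStabilityRegPr» of rung R3's K1, cell `ym3-torus`,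
seat `ym3-torus-p1` gen 13; memo HOME/UV3-NODE.md §22).  Theorems only; no new definition.

WHY.  The reshaped stub V4′ `stub_critCurvGradLog` (log-Lipschitz curvature gradient of (8)-regular critical configurations,
`T3CurvGradLog.CritCurvGradLogAt`) is proved by the cell for EVERY (8)-regular configuration: in the complete axial gauge on the
universal cover the transported plaquette field `Φ = F̃ − 1` solves a FLAT divergence-form Poisson system
`−ΔΦ = Σ_k (g_k(· + v_k) − g_k)` with `sup|g_k| = O(ε₁η³)` (covariant divergence (10) + lattice Bianchi + axial-gauge transport
errors), and the interior estimate `|∇Φ(0)| ≤ C(1 + log R)(Σ_k sup|g_k| + sup|Φ|/R)` on a box of radius `R = η⁻¹` (file 2/2,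
`…CurvGradFlatPoisson`) is the discrete Calderón–Zygmund endpoint: its kernel input is this file —
* §1 `exists_latticeGreen_abs_le` (`G` is bounded), **`exists_gHalf_grad_le`** (`|g(w ± eᵢ) − g(w)| ≤ K_g/(max 1 ‖w‖)^{d−1}`
  for ALL `w`), **`exists_gHalf_hess_le`** (`|g(w+eⱼ+eᵢ) − g(w+eⱼ) − g(w+eᵢ) + g(w)| ≤ K_h/(max 1 ‖w‖)^d` for ALL `w`) — the
  tree's Lawler bounds `latticeGreen_gradient_bound(_neg)`, `latticeGreen_second_diff_bound` (`LatticeGreenGradient`) in the sup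
  norm of `ℤ^d` with the finitely many excluded points absorbed;
* §2 shell decomposition of the sup-box `sbox N` and **`sum_sbox_inv_pow_le`**: `Σ_{y ∈ sbox N} (max 1 ‖y‖)^{−d} ≤
  1 + 2d·3^{d−1}(1 + log N)` (shell `s` has `≤ 2d(2s+1)^{d−1}` sites, harmonic sum `≤ 1 + log N`, Mathlib
  `harmonic_le_one_add_log`), and the recentred form `sum_sbox_inv_pow_shift_le`.

References: G. F. Lawler, *Intersections of Random Walks* (1991) Thm. 1.5.5; G. F. Lawler, V. Limic, *Random Walk: A Modern
Introduction* (2010) Thm. 4.3.1 (the kernel bounds, proved in the tree).  No sorry, standard axioms.  NOT a claim about the mass gap.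
-/

set_option autoImplicit false

noncomputable section

open Finset
open Literature.Probability.LatticeModels
open Literature.MathematicalPhysics.QuantumFieldTheory.LatticeForm (e)
open Summit.QuantumFields.YangMills.Theorems.WeakCouplingRates
  (abs_coord_le_norm norm_le_sqrt_sum_sq one_le_norm_of_ne_zero sqrt_rpow_le_inv_norm_pow norm_e)
open Summit.QuantumFields.YangMills.Theorems.WeakCouplingRates.HarmonicInterior

namespace Summit.QuantumFields.YangMills.Theorems.CurvGradFlat

variable {d : ℕ}

/-! ## §1 Uniform sup-norm bounds for `G`, `∇g`, `∇∇g` -/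

/-- **The lattice Green function is bounded** (`d ≥ 3`): `|G(x)| ≤ B` for all `x` (from the tree's asymptotics
`G = a|x|^{2−d} + O(|x|^{−d})` off the origin). [cite: LawlerLimic2010, Thm. 4.3.1] -/
theorem exists_latticeGreen_abs_le (hd : 3 ≤ d) : ∃ B : ℝ, 0 ≤ B ∧ ∀ x : Site d, |latticeGreen x| ≤ B := by
  obtain ⟨K, hK⟩ := latticeGreen_asymptotics (d := d) hd
  set a : ℝ := Real.Gamma ((d : ℝ) / 2 - 1) / (2 * Real.pi ^ ((d : ℝ) / 2)) with ha
  have ha0 : 0 ≤ a := by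
    have hd3 : (3 : ℝ) ≤ d := by exact_mod_cast hd
    have : 0 < Real.Gamma ((d : ℝ) / 2 - 1) := Real.Gamma_pos_of_pos (by linarith)
    positivity
  refine ⟨max |latticeGreen (0 : Site d)| (a + max K 0), le_max_of_le_left (abs_nonneg _), fun x => ?_⟩
  by_cases hx : x = 0
  · subst hx; exact le_max_left _ _
  · refine le_trans ?_ (le_max_right _ _)
    set r : ℝ := Real.sqrt (∑ i, ((x i : ℤ) : ℝ) ^ 2) with hr
    have hr1 : 1 ≤ r := (one_le_norm_of_ne_zero hx).trans (norm_le_sqrt_sum_sq x)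
    have hr0 : 0 < r := by linarith
    have h1 : r ^ (2 - (d : ℝ)) ≤ 1 :=
      Real.rpow_le_one_of_one_le_of_nonpos hr1 (by have h3 : (3 : ℝ) ≤ d := (by exact_mod_cast hd); linarith)
    have h2 : r ^ (-(d : ℝ)) ≤ 1 :=
      Real.rpow_le_one_of_one_le_of_nonpos hr1 (by have h0 : (0 : ℝ) ≤ d := (by positivity); linarith)
    have h3 := hK x hx
    have h4 : |latticeGreen x| ≤ |latticeGreen x - a * r ^ (2 - (d : ℝ))| + a * r ^ (2 - (d : ℝ)) := by
      have := abs_sub_abs_le_abs_sub (latticeGreen x) (a * r ^ (2 - (d : ℝ)))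
      rw [abs_of_nonneg (by positivity : 0 ≤ a * r ^ (2 - (d : ℝ)))] at this
      linarith
    have h5 : K * r ^ (-(d : ℝ)) ≤ max K 0 := by
      rcases le_or_gt 0 K with hK0 | hK0
      · calc K * r ^ (-(d : ℝ)) ≤ K * 1 := mul_le_mul_of_nonneg_left h2 hK0
          _ = K := mul_one K
          _ ≤ max K 0 := le_max_left _ _
      · exact le_trans (mul_nonpos_of_nonpos_of_nonneg hK0.le (Real.rpow_nonneg hr0.le _)) (le_max_right _ _)
    have h6 : a * r ^ (2 - (d : ℝ)) ≤ a := by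
      calc a * r ^ (2 - (d : ℝ)) ≤ a * 1 := mul_le_mul_of_nonneg_left h1 ha0
        _ = a := mul_one a
    linarith

/-- `max 1 ‖w‖ = ‖w‖` for `w ≠ 0`. [folklore] -/
theorem max_one_norm_of_ne_zero {w : Site d} (hw : w ≠ 0) : max 1 ‖w‖ = ‖w‖ :=
  max_eq_right (one_le_norm_of_ne_zero hw)

/-- `1 ≤ max 1 ‖w‖` and positivity of its powers (bookkeeping). [folklore] -/
theorem max_one_norm_pow_pos (w : Site d) (n : ℕ) : 0 < (max 1 ‖w‖) ^ n :=
  pow_pos (lt_of_lt_of_le zero_lt_one (le_max_left _ _)) n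

/-- **Uniform first-difference bound**: `|g(w + eᵢ) − g(w)| ≤ K_g/(max 1 ‖w‖)^{d−1}` and `|g(w − eᵢ) − g(w)| ≤ K_g/(max 1 ‖w‖)^{d−1}`
for ALL `w ∈ ℤ^d`, `g = G/2` (`gHalf`). [cite: Lawler1991, Thm. 1.5.5] -/
theorem exists_gHalf_grad_le (hd : 3 ≤ d) : ∃ Kg : ℝ, 0 ≤ Kg ∧ ∀ (w : Site d) (i : Fin d),
    |gHalf (w + e i) - gHalf w| ≤ Kg / (max 1 ‖w‖) ^ (d - 1) ∧
    |gHalf (w - e i) - gHalf w| ≤ Kg / (max 1 ‖w‖) ^ (d - 1) := by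
  obtain ⟨K, hK0, hK⟩ := latticeGreen_gradient_bound (d := d) hd
  obtain ⟨K', hK'0, hK'⟩ := latticeGreen_gradient_bound_neg (d := d) hd
  obtain ⟨B, hB0, hB⟩ := exists_latticeGreen_abs_le (d := d) hd
  have hd1 : (1 : ℝ) - (d : ℝ) = -((d - 1 : ℕ) : ℝ) := by
    rw [Nat.cast_sub (by omega : 1 ≤ d)]; push_cast; ring
  refine ⟨max (max K K') B, le_max_of_le_right hB0, fun w i => ?_⟩
  have hgh : ∀ z : Site d, gHalf z = latticeGreen z / 2 := fun z => rfl
  by_cases hw : w = 0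
  · -- at the origin: `max 1 ‖0‖ = 1`, bound by `B`
    subst hw
    have h1 : max 1 ‖(0 : Site d)‖ = 1 := by rw [norm_zero, max_eq_left zero_le_one]
    rw [h1, one_pow, div_one]
    have hb : ∀ z z' : Site d, |gHalf z - gHalf z'| ≤ B := by
      intro z z'
      rw [hgh, hgh, show latticeGreen z / 2 - latticeGreen z' / 2 = (latticeGreen z - latticeGreen z') / 2 by ring,
        abs_div, abs_two]
      have := abs_sub (latticeGreen z) (latticeGreen z')
      have := hB z; have := hB z'
      linarith
    exact ⟨(hb _ _).trans (le_max_right _ _), (hb _ _).trans (le_max_right _ _)⟩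
  · rw [max_one_norm_of_ne_zero hw]
    have hpow := sqrt_rpow_le_inv_norm_pow hw (d - 1) hd1
    have hnn : 0 < ‖w‖ ^ (d - 1) := pow_pos (lt_of_lt_of_le zero_lt_one (one_le_norm_of_ne_zero hw)) _
    constructor
    · have h := hK w hw i
      rw [show (Pi.single i 1 : Site d) = e i from rfl] at h
      rw [hgh, hgh, show latticeGreen (w + e i) / 2 - latticeGreen w / 2 = (latticeGreen (w + e i) - latticeGreen w) / 2 by ring,
        abs_div, abs_two]
      calc |latticeGreen (w + e i) - latticeGreen w| / 2 ≤ |latticeGreen (w + e i) - latticeGreen w| := by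
            have := abs_nonneg (latticeGreen (w + e i) - latticeGreen w); linarith
        _ ≤ K * (1 / ‖w‖ ^ (d - 1)) := h.trans (mul_le_mul_of_nonneg_left hpow hK0)
        _ ≤ max (max K K') B * (1 / ‖w‖ ^ (d - 1)) :=
            mul_le_mul_of_nonneg_right ((le_max_left _ _).trans (le_max_left _ _)) (by positivity)
        _ = max (max K K') B / ‖w‖ ^ (d - 1) := by ring
    · have h := hK' w hw i
      rw [show (Pi.single i 1 : Site d) = e i from rfl] at h
      rw [hgh, hgh, show latticeGreen (w - e i) / 2 - latticeGreen w / 2 = (latticeGreen (w - e i) - latticeGreen w) / 2 by ring,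
        abs_div, abs_two]
      calc |latticeGreen (w - e i) - latticeGreen w| / 2 ≤ |latticeGreen (w - e i) - latticeGreen w| := by
            have := abs_nonneg (latticeGreen (w - e i) - latticeGreen w); linarith
        _ ≤ K' * (1 / ‖w‖ ^ (d - 1)) := h.trans (mul_le_mul_of_nonneg_left hpow hK'0)
        _ ≤ max (max K K') B * (1 / ‖w‖ ^ (d - 1)) :=
            mul_le_mul_of_nonneg_right ((le_max_right _ _).trans (le_max_left _ _)) (by positivity)
        _ = max (max K K') B / ‖w‖ ^ (d - 1) := by ring

/-- **Uniform second-difference bound**: `|g(w + eⱼ + eᵢ) − g(w + eⱼ) − g(w + eᵢ) + g(w)| ≤ K_h/(max 1 ‖w‖)^d` for ALL `w ∈ ℤ^d`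
(the two excluded points `w = 0`, `w = −eⱼ` of the tree's statement have `max 1 ‖w‖ = 1` and are absorbed by `2B`).
[cite: Lawler1991, Thm. 1.5.5] -/
theorem exists_gHalf_hess_le (hd : 3 ≤ d) : ∃ Kh : ℝ, 0 ≤ Kh ∧ ∀ (w : Site d) (i j : Fin d),
    |gHalf (w + e j + e i) - gHalf (w + e j) - gHalf (w + e i) + gHalf w| ≤ Kh / (max 1 ‖w‖) ^ d := by
  obtain ⟨K, hK0, hK⟩ := latticeGreen_second_diff_bound (d := d) hd
  obtain ⟨B, hB0, hB⟩ := exists_latticeGreen_abs_le (d := d) hd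
  refine ⟨max K (2 * B), le_max_of_le_left hK0, fun w i j => ?_⟩
  have hgh : ∀ z : Site d, gHalf z = latticeGreen z / 2 := fun z => rfl
  have hexp : gHalf (w + e j + e i) - gHalf (w + e j) - gHalf (w + e i) + gHalf w =
      (latticeGreen (w + e j + e i) - latticeGreen (w + e j) - latticeGreen (w + e i) + latticeGreen w) / 2 := by
    simp only [hgh]; ring
  by_cases hgood : w ≠ 0 ∧ w + e j ≠ 0
  · have h := hK w hgood.1 i j (by rw [show (Pi.single j 1 : Site d) = e j from rfl]; exact hgood.2)
    simp only [show (Pi.single i 1 : Site d) = e i from rfl, show (Pi.single j 1 : Site d) = e j from rfl] at h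
    have hpow := sqrt_rpow_le_inv_norm_pow hgood.1 d (s := -(d : ℝ)) rfl
    rw [max_one_norm_of_ne_zero hgood.1, hexp, abs_div, abs_two]
    have hnn : 0 < ‖w‖ ^ d := pow_pos (lt_of_lt_of_le zero_lt_one (one_le_norm_of_ne_zero hgood.1)) _
    calc |latticeGreen (w + e j + e i) - latticeGreen (w + e j) - latticeGreen (w + e i) + latticeGreen w| / 2
        ≤ |latticeGreen (w + e j + e i) - latticeGreen (w + e j) - latticeGreen (w + e i) + latticeGreen w| := by
          have := abs_nonneg (latticeGreen (w + e j + e i) - latticeGreen (w + e j) - latticeGreen (w + e i) + latticeGreen w)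
          linarith
      _ ≤ K * (1 / ‖w‖ ^ d) := h.trans (mul_le_mul_of_nonneg_left hpow hK0)
      _ ≤ max K (2 * B) * (1 / ‖w‖ ^ d) := mul_le_mul_of_nonneg_right (le_max_left _ _) (by positivity)
      _ = max K (2 * B) / ‖w‖ ^ d := by ring
  · -- the two excluded points: `‖w‖ ≤ 1`
    have hw1 : ‖w‖ ≤ 1 := by
      rw [not_and_or, not_ne_iff, not_ne_iff] at hgood
      rcases hgood with h | h
      · rw [h, norm_zero]; exact zero_le_one
      · rw [eq_neg_of_add_eq_zero_left h, norm_neg, norm_e]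
    rw [max_eq_left hw1, one_pow, div_one, hexp, abs_div, abs_two]
    have h4 : |latticeGreen (w + e j + e i) - latticeGreen (w + e j) - latticeGreen (w + e i) + latticeGreen w| ≤ 4 * B := by
      have h1 := hB (w + e j + e i); have h2 := hB (w + e j); have h3 := hB (w + e i); have h4 := hB w
      have := abs_add_le (latticeGreen (w + e j + e i) - latticeGreen (w + e j)) (-(latticeGreen (w + e i)) + latticeGreen w)
      have := abs_sub (latticeGreen (w + e j + e i)) (latticeGreen (w + e j))
      have := abs_add_le (-(latticeGreen (w + e i))) (latticeGreen w)
      rw [abs_neg] at this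
      have e1 : latticeGreen (w + e j + e i) - latticeGreen (w + e j) - latticeGreen (w + e i) + latticeGreen w =
          (latticeGreen (w + e j + e i) - latticeGreen (w + e j)) + (-(latticeGreen (w + e i)) + latticeGreen w) := by ring
      rw [e1]
      linarith
    calc |latticeGreen (w + e j + e i) - latticeGreen (w + e j) - latticeGreen (w + e i) + latticeGreen w| / 2
        ≤ 2 * B := by linarith
      _ ≤ max K (2 * B) := le_max_right _ _


/-! ## §2 Shell decomposition of the sup-box and the logarithmic sum -/

/-- `sbox s ⊆ sbox (s + 1)`. [folklore] -/
theorem sbox_subset_succ (s : ℕ) : sbox (d := d) s ⊆ sbox (s + 1) := by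
  intro z hz
  rw [mem_sbox] at hz ⊢
  intro k; have := hz k; push_cast; omega

/-- More generally `sbox s ⊆ sbox t` for `s ≤ t`. [folklore] -/
theorem sbox_mono {s t : ℕ} (hst : s ≤ t) : sbox (d := d) s ⊆ sbox t := by
  intro z hz
  rw [mem_sbox] at hz ⊢
  intro k; have h1 := hz k; have h2 : (s : ℤ) ≤ t := (by exact_mod_cast hst); omega

/-- A site of the shell `sbox (s+1) ∖ sbox s` has sup norm at least `s + 1`. [folklore] -/
theorem succ_le_norm_of_mem_shell {s : ℕ} {y : Site d} (hy : y ∈ sbox (s + 1) \ sbox s) : (s : ℝ) + 1 ≤ ‖y‖ := by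
  obtain ⟨k, hk⟩ := not_mem_sbox.1 (Finset.mem_sdiff.1 hy).2
  have h : (s : ℝ) + 1 ≤ |((y k : ℤ) : ℝ)| := by
    have : (s : ℤ) + 1 ≤ |y k| := by omega
    exact_mod_cast this
  exact h.trans (abs_coord_le_norm y k)

/-- `a^n − b^n ≤ n (a − b) a^{n−1}` for reals `0 ≤ b ≤ a`. [folklore] -/
theorem pow_sub_pow_le_mul {a b : ℝ} (hb : 0 ≤ b) (hab : b ≤ a) :
    ∀ n : ℕ, a ^ n - b ^ n ≤ n * (a - b) * a ^ (n - 1)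
  | 0 => by simp
  | 1 => by simp
  | (n + 2) => by
    have ih := pow_sub_pow_le_mul hb hab (n + 1)
    have ha : 0 ≤ a := hb.trans hab
    rw [show n + 1 - 1 = n from rfl] at ih
    rw [show n + 2 - 1 = n + 1 from rfl]
    have e1 : a ^ (n + 2) - b ^ (n + 2) = a * (a ^ (n + 1) - b ^ (n + 1)) + (a - b) * b ^ (n + 1) := by ring
    rw [e1]
    have h1 : a * (a ^ (n + 1) - b ^ (n + 1)) ≤ a * ((n + 1 : ℕ) * (a - b) * a ^ n) := mul_le_mul_of_nonneg_left ih ha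
    have h2 : (a - b) * b ^ (n + 1) ≤ (a - b) * a ^ (n + 1) :=
      mul_le_mul_of_nonneg_left (pow_le_pow_left₀ hb hab _) (by linarith)
    calc a * (a ^ (n + 1) - b ^ (n + 1)) + (a - b) * b ^ (n + 1)
        ≤ a * ((n + 1 : ℕ) * (a - b) * a ^ n) + (a - b) * a ^ (n + 1) := add_le_add h1 h2
      _ = ((n + 2 : ℕ) : ℝ) * (a - b) * a ^ (n + 1) := by push_cast; ring

/-- **The shell count**: `#(sbox (s+1) ∖ sbox s) ≤ 2d (2s + 3)^{d−1}`. [folklore] -/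
theorem card_shell_le (s : ℕ) : (#(sbox (d := d) (s + 1) \ sbox s) : ℝ) ≤ 2 * d * (2 * s + 3) ^ (d - 1) := by
  rw [Finset.card_sdiff_of_subset (sbox_subset_succ s), card_sbox, card_sbox]
  have hle : (2 * s + 1) ^ d ≤ (2 * (s + 1) + 1) ^ d := Nat.pow_le_pow_left (by omega) d
  rw [Nat.cast_sub hle]
  push_cast
  have h := pow_sub_pow_le_mul (a := 2 * (s : ℝ) + 3) (b := 2 * (s : ℝ) + 1) (by positivity) (by linarith) d
  have e1 : (2 * ((s : ℝ) + 1) + 1) = 2 * (s : ℝ) + 3 := by ring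
  rw [e1]
  calc (2 * (s : ℝ) + 3) ^ d - (2 * (s : ℝ) + 1) ^ d ≤ d * ((2 * (s : ℝ) + 3) - (2 * (s : ℝ) + 1)) * (2 * (s : ℝ) + 3) ^ (d - 1) := h
    _ = 2 * d * (2 * (s : ℝ) + 3) ^ (d - 1) := by ring

/-- The summand of the logarithmic sum is at most `1`. [folklore] -/
theorem inv_max_one_norm_pow_le_one (y : Site d) : ((max 1 ‖y‖) ^ d)⁻¹ ≤ 1 :=
  inv_le_one_of_one_le₀ (one_le_pow₀ (le_max_left _ _))

/-- The summand on the shell `‖y‖ ≥ s + 1` is at most `(s+1)^{−d}`. [folklore] -/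
theorem inv_max_one_norm_pow_le_of_mem_shell {s : ℕ} {y : Site d} (hy : y ∈ sbox (s + 1) \ sbox s) :
    ((max 1 ‖y‖) ^ d)⁻¹ ≤ (((s : ℝ) + 1) ^ d)⁻¹ := by
  have h1 : (s : ℝ) + 1 ≤ max 1 ‖y‖ := (succ_le_norm_of_mem_shell hy).trans (le_max_right _ _)
  have h0 : (0 : ℝ) < (s : ℝ) + 1 := by positivity
  exact inv_anti₀ (pow_pos h0 d) (pow_le_pow_left₀ h0.le h1 d)

/-- **THE LOGARITHMIC SHELL SUM**, harmonic form: `Σ_{y ∈ sbox N} (max 1 ‖y‖)^{−d} ≤ 1 + 2d·3^{d−1}·H_N` (`d ≥ 1`). [folklore] -/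
theorem sum_sbox_inv_pow_le_harmonic (hd : 1 ≤ d) (N : ℕ) :
    ∑ y ∈ sbox (d := d) N, ((max 1 ‖y‖) ^ d)⁻¹ ≤ 1 + 2 * d * 3 ^ (d - 1) * (harmonic N : ℝ) := by
  induction N with
  | zero =>
    rw [harmonic_zero, Rat.cast_zero, mul_zero, add_zero]
    calc ∑ y ∈ sbox (d := d) 0, ((max 1 ‖y‖) ^ d)⁻¹ ≤ ∑ _y ∈ sbox (d := d) 0, (1 : ℝ) :=
          Finset.sum_le_sum fun y _ => inv_max_one_norm_pow_le_one y
      _ = 1 := by rw [Finset.sum_const, card_sbox, nsmul_eq_mul, mul_one]; simp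
  | succ N ih =>
    rw [← Finset.sum_sdiff (sbox_subset_succ N), harmonic_succ, Rat.cast_add, Rat.cast_inv, Rat.cast_natCast]
    have hshell : ∑ y ∈ sbox (d := d) (N + 1) \ sbox N, ((max 1 ‖y‖) ^ d)⁻¹ ≤ 2 * d * 3 ^ (d - 1) * ((N + 1 : ℕ) : ℝ)⁻¹ := by
      calc ∑ y ∈ sbox (d := d) (N + 1) \ sbox N, ((max 1 ‖y‖) ^ d)⁻¹
          ≤ ∑ _y ∈ sbox (d := d) (N + 1) \ sbox N, (((N : ℝ) + 1) ^ d)⁻¹ :=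
            Finset.sum_le_sum fun y hy => inv_max_one_norm_pow_le_of_mem_shell hy
        _ = #(sbox (d := d) (N + 1) \ sbox N) * (((N : ℝ) + 1) ^ d)⁻¹ := by rw [Finset.sum_const, nsmul_eq_mul]
        _ ≤ 2 * d * (2 * N + 3) ^ (d - 1) * (((N : ℝ) + 1) ^ d)⁻¹ :=
            mul_le_mul_of_nonneg_right (card_shell_le N) (by positivity)
        _ ≤ 2 * d * (3 * ((N : ℝ) + 1)) ^ (d - 1) * (((N : ℝ) + 1) ^ d)⁻¹ := by
            gcongr; linarith
        _ = 2 * d * 3 ^ (d - 1) * ((N + 1 : ℕ) : ℝ)⁻¹ := by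
            have hN : (0 : ℝ) < (N : ℝ) + 1 := by positivity
            have hd' : d = (d - 1) + 1 := by omega
            rw [mul_pow, show (((N : ℝ) + 1) ^ d) = ((N : ℝ) + 1) ^ (d - 1) * ((N : ℝ) + 1) by
              conv_lhs => rw [hd']
              rw [pow_succ]]
            push_cast
            field_simp
    have h0 : (0 : ℝ) ≤ 2 * d * 3 ^ (d - 1) := by positivity
    nlinarith [hshell, ih, h0]

/-- **THE LOGARITHMIC SHELL SUM**: `Σ_{y ∈ sbox N} (max 1 ‖y‖)^{−d} ≤ (1 + 2d·3^{d−1})(2 + log N)` for `N ≥ 1`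
(`H_N ≤ 1 + log N`, Mathlib `harmonic_le_one_add_log`). [folklore] -/
theorem sum_sbox_inv_pow_le (hd : 1 ≤ d) {N : ℕ} (hN : 1 ≤ N) :
    ∑ y ∈ sbox (d := d) N, ((max 1 ‖y‖) ^ d)⁻¹ ≤ (1 + 2 * d * 3 ^ (d - 1)) * (2 + Real.log N) := by
  have h1 := sum_sbox_inv_pow_le_harmonic (d := d) hd N
  have h2 := harmonic_le_one_add_log N
  have hlog : 0 ≤ Real.log N := Real.log_nonneg (by exact_mod_cast hN)
  have h0 : (0 : ℝ) ≤ 2 * d * 3 ^ (d - 1) := by positivity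
  nlinarith [h1, h2, hlog, h0]

/-- Recentring: for `‖x‖ ≤ 2`, `(max 1 ‖y‖)^d ≤ 3^d (max 1 ‖x − y‖)^d`, whence `(max 1 ‖x − y‖)^{−d} ≤ 3^d (max 1 ‖y‖)^{−d}`. [folklore] -/
theorem inv_max_one_norm_sub_pow_le {x : Site d} (hx : ‖x‖ ≤ 2) (y : Site d) :
    ((max 1 ‖x - y‖) ^ d)⁻¹ ≤ 3 ^ d * ((max 1 ‖y‖) ^ d)⁻¹ := by
  have hm : 0 < max 1 ‖x - y‖ := lt_of_lt_of_le zero_lt_one (le_max_left _ _)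
  have h1 : max 1 ‖y‖ ≤ 3 * max 1 ‖x - y‖ := by
    refine max_le (by linarith [le_max_left (1 : ℝ) ‖x - y‖]) ?_
    have : ‖y‖ ≤ ‖x‖ + ‖x - y‖ := by
      have := norm_sub_le x (x - y); rwa [sub_sub_cancel] at this
    linarith [le_max_left (1 : ℝ) ‖x - y‖, le_max_right (1 : ℝ) ‖x - y‖]
  have h2 : (max 1 ‖y‖) ^ d ≤ (3 * max 1 ‖x - y‖) ^ d := pow_le_pow_left₀ (le_trans zero_le_one (le_max_left _ _)) h1 d
  rw [mul_pow] at h2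
  have h3 : 0 < (max 1 ‖y‖) ^ d := max_one_norm_pow_pos y d
  have h4 : 0 < (max 1 ‖x - y‖) ^ d := max_one_norm_pow_pos (x - y) d
  rw [inv_le_comm₀ h4 (by positivity), mul_inv, inv_inv, ← div_eq_inv_mul]
  rw [div_le_iff₀ (by positivity)]
  linarith

/-- **The recentred logarithmic sum**: for `‖x‖ ≤ 2` and `N ≥ 1`,
`Σ_{y ∈ sbox N} (max 1 ‖x − y‖)^{−d} ≤ 3^d (1 + 2d·3^{d−1})(2 + log N)`. [folklore] -/
theorem sum_sbox_inv_pow_shift_le (hd : 1 ≤ d) {N : ℕ} (hN : 1 ≤ N) {x : Site d} (hx : ‖x‖ ≤ 2) :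
    ∑ y ∈ sbox (d := d) N, ((max 1 ‖x - y‖) ^ d)⁻¹ ≤ 3 ^ d * ((1 + 2 * d * 3 ^ (d - 1)) * (2 + Real.log N)) := by
  calc ∑ y ∈ sbox (d := d) N, ((max 1 ‖x - y‖) ^ d)⁻¹ ≤ ∑ y ∈ sbox (d := d) N, 3 ^ d * ((max 1 ‖y‖) ^ d)⁻¹ :=
        Finset.sum_le_sum fun y _ => inv_max_one_norm_sub_pow_le hx y
    _ = 3 ^ d * ∑ y ∈ sbox (d := d) N, ((max 1 ‖y‖) ^ d)⁻¹ := by rw [Finset.mul_sum]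
    _ ≤ 3 ^ d * ((1 + 2 * d * 3 ^ (d - 1)) * (2 + Real.log N)) :=
        mul_le_mul_of_nonneg_left (sum_sbox_inv_pow_le hd hN) (by positivity)

end Summit.QuantumFields.YangMills.Theorems.CurvGradFlat

end
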